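import Mathlib
import Summits.QuantumFields.YangMills.Theorems.CoarseStiffnessTailCappedCoarseStiffnessLPressureConvexity
import Summits.QuantumFields.YangMills.Theorems.CoarseStiffnessTailCappedCoarseStiffnessLBareUniformCount
import Summits.QuantumFields.YangMills.Theorems.CoarseStiffnessTailCappedCoarseStiffnessLEdgeBulk

/-!
# Route `CoarseStiffnessTail` — UNIFORM MEAN ACTION versus the BARE STIFFNESSES (capped, sub-threshold, uncapped) of the Wilson law on
# Bałaban's three-tori (lead's certificate, seat `ym-line-cst-p1` g12; helper on stmt-QuantumFields-25301; part 2 of 3, toolkit = part 1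
# `…CappedCoarseStiffnessLPressureConvexity`, dictionary = part 3 `…CappedCoarseStiffnessLMeanAction`)

Write (one family `F`, coupling `γ`, cut-off `K`; `β_K = (γL^{−K})⁻¹`, `Gibbs_K = T3UnitScaleTilt.gibbsK F ℰp γ K`, `#Plaq_0` plaquettes of
the finest torus), all in the crux's quantifier format `∀ L (b₀ p₀) ∃ constants ∀ F (F.L = L) ∀ γ ≤ γ₁ ∀ K`:
* UMA   `β_K·∫Σ_a|U(∂a) − 1|² dGibbs_K ≤ C·#Plaq_0`;
* UBS   `∫exp(c₀β_K·Σ_a|U(∂a) − 1|²) dGibbs_K ≤ exp(C₀·#Plaq_0)` (UNCAPPED bare stiffness);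
* CRUX₀ `∫exp(c₀β_K·Σ_a min(|U(∂a) − 1|², θ(K)²)) dGibbs_K ≤ exp(C₀·#Plaq_0)` (the typed crux `CappedCoarseStiffnessL` at `j = 0`);
* BULK₀ `∫exp(c₀β_K·Σ_a |U(∂a) − 1|²·1[|U(∂a) − 1| < θ(K)]) dGibbs_K ≤ exp(C₀·#Plaq_0)` (the registered `stub_subThresholdStiffness` at `j = 0`).

THE THEOREMS (definition-free).
(UMA ⇒ UBS is part 1's `CoarseStiffnessTailPressureConvexity.ubs_of_uma`.)
§4 `crux0_of_ubs`, `bulk0_of_ubs` — **UBS ⇒ CRUX₀, BULK₀** for every profile, same constants (pointwise domination).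
§5 `uma_of_crux0`, `uma_of_bulk0` — **CRUX₀ ⇒ UMA, BULK₀ ⇒ UMA**: at the profile `(b₀, p₀) = (1, 3)`, below the window edge JENSEN
   (`c₀β_K∫X ≤ log∫e^{c₀β_KX} ≤ C₀#Plaq_0`), above it `|U(∂a) − 1|² ≤ 4` and the LANDED joint Peierls–chessboard bound of g9 for one plaquette
   (`singlePeierls_bare` from `CoarseStiffnessTailBareUniformCount.jointPeierls_bare`: `Gibbs_K{θ(K) ≤ |U(∂a) − 1|} ≤ e^{−p(g_K)²/24}`), whose rate
   beats one power of `β_K` once `γ ≤ e^{−144}` (`beta_mul_exp_neg_profile_le_one`: `p(g_K)² ≥ 36 log β_K` by `sq_pFun_ge`); engine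
   `mean_sqSum_le_of_tilt`.

HONEST SCOPE.  Elementary (Jensen, the Gibbs variational sandwich, compact-group arithmetic) composed by name with landed certificates; UMA itself is
NOT proved; nothing of Bałaban's (5)/(70)/(71); the crux 25301, both registered stubs at `j ≥ 1`, `HistoryTailL` 19936 stay OPEN; no rung, leaf or
summit is proved — `YM3TorusSU2` (R3, RECORD rung, not Clay) is NOT proved; the Yang–Mills mass gap is NOT touched.

References: T. Bałaban, CMP **102** (1985) 255–275 [Balaban1985UV3] ((1)–(3) p.256, (5) p.256, (7) p.257, (11) p.258, (71) p.273); J. Fröhlich,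
R. Israel, E. H. Lieb, B. Simon, CMP **62** (1978) 1–34 [FrohlichIsraelLiebSimon1978] (Thm 4.1, behind `jointPeierls_bare`).
-/

noncomputable section

namespace Summit.QuantumFields.YangMills.Theorems.CoarseStiffnessTailBareStiffnessOfMeanAction

open MeasureTheory ProbabilityTheory Finset
open Literature.MathematicalPhysics.QuantumFieldTheory
open Literature.MathematicalPhysics.QuantumFieldTheory.Balaban1983to89
open Literature.MathematicalPhysics.QuantumFieldTheory.Balaban1983to89.T3ContinuumYM3Torus
open Literature.MathematicalPhysics.QuantumFieldTheory.Balaban1983to89.T3UnitScaleTilt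
open Literature.MathematicalPhysics.QuantumFieldTheory.Balaban1983to89.T3UnitLawDensityEML
open Literature.MathematicalPhysics.QuantumFieldTheory.Balaban1983to89.Missing
open Literature.MathematicalPhysics.QuantumFieldTheory.Balaban1983to89.T4StabilityFloorUnitary
  (one_sub_reTr_le_half_dist1_sq_specialUnitary wilsonAction4_eq_sum)
open Literature.MathematicalPhysics.QuantumFieldTheory.Balaban1983to89.B10Eq71TorusLocal (dist1_sq_le_specialUnitaryGroup)
open Literature.MathematicalPhysics.QuantumFieldTheory.Balaban1983to89.T4PairDerivBridge (dist1_le_two_specialUnitaryGroup)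
open Summit.QuantumFields.YangMills.Theorems.CoarseStiffnessTailBareUniformCount (jointPeierls_bare sq_pFun_ge coupling_facts)
open Summit.QuantumFields.YangMills.Theorems.CoarseStiffnessTailPressureConvexity

/-! ## §4 UNCAPPED BARE STIFFNESS ⇒ the `j = 0` faces of the crux (capped) and of the BULK stub (sub-threshold): domination -/

section StiffnessToFaces

/-- **UNCAPPED ⇒ CAPPED** (the `j = 0` face of `CappedCoarseStiffnessL`, for EVERY profile `(b₀, p₀)`, same constants):
`min(|U(∂a) − 1|², θ(K)²) ≤ |U(∂a) − 1|²` pointwise. [folklore] -/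
theorem crux0_of_ubs
    (h : ∀ (L : ℕ), ∃ (c₀ C₀ γ₁ : ℝ), 0 < c₀ ∧ 0 < γ₁ ∧ γ₁ ≤ 1 ∧ ∀ (F : T3Family) (γ : ℝ), F.L = L → 0 < γ → γ ≤ γ₁ → ∀ (K : ℕ),
      ∫ U, Real.exp (c₀ * (γ * ((F.L : ℝ)⁻¹) ^ K)⁻¹ * ∑ a : Plaq (F.P K) 0, dist1 (GaugeField.plaqHol U a) ^ 2)
          ∂(gibbsK F ℰp γ K) ≤ Real.exp (C₀ * (Fintype.card (Plaq (F.P K) 0) : ℝ))) :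
    ∀ (L : ℕ) (b₀ p₀ : ℝ), 0 < b₀ → 2 < p₀ → ∃ (c₀ C₀ γ₁ : ℝ), 0 < c₀ ∧ 0 < γ₁ ∧ γ₁ ≤ 1 ∧
      ∀ (F : T3Family) (γ : ℝ), F.L = L → 0 < γ → γ ≤ γ₁ → ∀ (K : ℕ),
        ∫ U, Real.exp (c₀ * (γ * ((F.L : ℝ)⁻¹) ^ K)⁻¹ *
            ∑ a : Plaq (F.P K) 0, min (dist1 (GaugeField.plaqHol U a) ^ 2) (θBal F.L γ b₀ p₀ K ^ 2)) ∂(gibbsK F ℰp γ K) ≤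
          Real.exp (C₀ * (Fintype.card (Plaq (F.P K) 0) : ℝ)) := by
  intro L b₀ p₀ _ _
  obtain ⟨c₀, C₀, γ₁, hc₀, hγ₁, hγ₁1, hS⟩ := h L
  refine ⟨c₀, C₀, γ₁, hc₀, hγ₁, hγ₁1, fun F γ hL hγ hγle K => (le_trans ?_ (hS F γ hL hγ hγle K))⟩
  set β : ℝ := (γ * ((F.L : ℝ)⁻¹) ^ K)⁻¹ with hβdef
  have hβ0 : 0 < β := CoarseStiffnessTailEdgeBulk.beta_pos F hγ K
  haveI := isProbabilityMeasure_gibbsK F ℰp hγ.le K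
  refine integral_mono_of_nonneg (ae_of_all _ fun U => (Real.exp_pos _).le) ?_ (ae_of_all _ fun U => ?_)
  · refine integrable_of_bounded (((measurable_sqSum F K).const_mul _).exp)
      (M := Real.exp (c₀ * β * (4 * (Fintype.card (Plaq (F.P K) 0) : ℝ)))) fun U => ?_
    rw [abs_of_pos (Real.exp_pos _)]
    exact Real.exp_le_exp.mpr (mul_le_mul_of_nonneg_left (sqSum_mem F U).2 (by positivity))
  · refine Real.exp_le_exp.mpr (mul_le_mul_of_nonneg_left ?_ (by positivity))
    exact Finset.sum_le_sum fun a _ => min_le_left _ _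

/-- **UNCAPPED ⇒ SUB-THRESHOLD** (the `j = 0` face of the registered BULK stub `stub_subThresholdStiffness`, every profile, same constants):
`|U(∂a) − 1|²·1[|U(∂a) − 1| < θ] ≤ |U(∂a) − 1|²` pointwise. [folklore] -/
theorem bulk0_of_ubs
    (h : ∀ (L : ℕ), ∃ (c₀ C₀ γ₁ : ℝ), 0 < c₀ ∧ 0 < γ₁ ∧ γ₁ ≤ 1 ∧ ∀ (F : T3Family) (γ : ℝ), F.L = L → 0 < γ → γ ≤ γ₁ → ∀ (K : ℕ),
      ∫ U, Real.exp (c₀ * (γ * ((F.L : ℝ)⁻¹) ^ K)⁻¹ * ∑ a : Plaq (F.P K) 0, dist1 (GaugeField.plaqHol U a) ^ 2)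
          ∂(gibbsK F ℰp γ K) ≤ Real.exp (C₀ * (Fintype.card (Plaq (F.P K) 0) : ℝ))) :
    ∀ (L : ℕ) (b₀ p₀ : ℝ), 0 < b₀ → 2 < p₀ → ∃ (c₀ C₀ γ₁ : ℝ), 0 < c₀ ∧ 0 < γ₁ ∧ γ₁ ≤ 1 ∧
      ∀ (F : T3Family) (γ : ℝ), F.L = L → 0 < γ → γ ≤ γ₁ → ∀ (K : ℕ),
        ∫ U, Real.exp (c₀ * (γ * ((F.L : ℝ)⁻¹) ^ K)⁻¹ *
            ∑ a : Plaq (F.P K) 0, (if dist1 (GaugeField.plaqHol U a) < θBal F.L γ b₀ p₀ K then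
              dist1 (GaugeField.plaqHol U a) ^ 2 else 0)) ∂(gibbsK F ℰp γ K) ≤
          Real.exp (C₀ * (Fintype.card (Plaq (F.P K) 0) : ℝ)) := by
  intro L b₀ p₀ _ _
  obtain ⟨c₀, C₀, γ₁, hc₀, hγ₁, hγ₁1, hS⟩ := h L
  refine ⟨c₀, C₀, γ₁, hc₀, hγ₁, hγ₁1, fun F γ hL hγ hγle K => (le_trans ?_ (hS F γ hL hγ hγle K))⟩
  set β : ℝ := (γ * ((F.L : ℝ)⁻¹) ^ K)⁻¹ with hβdef
  have hβ0 : 0 < β := CoarseStiffnessTailEdgeBulk.beta_pos F hγ K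
  haveI := isProbabilityMeasure_gibbsK F ℰp hγ.le K
  refine integral_mono_of_nonneg (ae_of_all _ fun U => (Real.exp_pos _).le) ?_ (ae_of_all _ fun U => ?_)
  · refine integrable_of_bounded (((measurable_sqSum F K).const_mul _).exp)
      (M := Real.exp (c₀ * β * (4 * (Fintype.card (Plaq (F.P K) 0) : ℝ)))) fun U => ?_
    rw [abs_of_pos (Real.exp_pos _)]
    exact Real.exp_le_exp.mpr (mul_le_mul_of_nonneg_left (sqSum_mem F U).2 (by positivity))
  · refine Real.exp_le_exp.mpr (mul_le_mul_of_nonneg_left ?_ (by positivity))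
    refine Finset.sum_le_sum fun a _ => ?_
    split_ifs
    · exact le_rfl
    · exact sq_nonneg _

end StiffnessToFaces

/-! ## §5 The `j = 0` faces of the crux / of the BULK stub ⇒ UNIFORM MEAN ACTION (Jensen below the window edge, the landed
joint Peierls bound `jointPeierls_bare` above it) -/

section FacesToMean

variable (F : T3Family)

/-- The indicator integral: `∫ 4·1[θ ≤ |U(∂a) − 1|] dGibbs_K = 4·Gibbs_K{θ ≤ |U(∂a) − 1|}`. [folklore] -/
theorem integral_edge_indicator (γ : ℝ) (K : ℕ) (θ : ℝ) (a : Plaq (F.P K) 0) :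
    ∫ U, (if θ ≤ dist1 (GaugeField.plaqHol U a) then (4 : ℝ) else 0) ∂(gibbsK F ℰp γ K) =
      4 * (gibbsK F ℰp γ K).real {U | θ ≤ dist1 (GaugeField.plaqHol U a)} := by
  have hS : MeasurableSet {U : GaugeField (F.P K) 0 (Matrix.specialUnitaryGroup (Fin 2) ℂ) | θ ≤ dist1 (GaugeField.plaqHol U a)} :=
    measurableSet_le measurable_const (measurable_dist1_plaqHol F K a)
  have hfun : (fun U : GaugeField (F.P K) 0 (Matrix.specialUnitaryGroup (Fin 2) ℂ) =>
      (if θ ≤ dist1 (GaugeField.plaqHol U a) then (4 : ℝ) else 0)) =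
      Set.indicator {U | θ ≤ dist1 (GaugeField.plaqHol U a)} (fun _ => (4 : ℝ)) := by
    funext U
    by_cases hU : θ ≤ dist1 (GaugeField.plaqHol U a)
    · rw [if_pos hU, Set.indicator_of_mem (show U ∈ {U | θ ≤ dist1 (GaugeField.plaqHol U a)} from hU)]
    · rw [if_neg hU, Set.indicator_of_notMem (show U ∉ {U | θ ≤ dist1 (GaugeField.plaqHol U a)} from hU)]
  rw [hfun, integral_indicator_const _ hS, smul_eq_mul, mul_comm]

/-- **THE PROFILE BEATS ONE POWER OF `β`**: for `0 < γ ≤ e^{−144}` (`γ ≤ 1`) and every cut-off, `β_K·exp(−p(g_K)²/24) ≤ 1` at the profile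
`(b₀, p₀) = (1, 3)` — since `p(g_K)² ≥ 72·log g_K⁻¹ = 36·log β_K` (`sq_pFun_ge`). [cite: Balaban1985UV3, (7) p.257] -/
theorem beta_mul_exp_neg_profile_le_one {γ : ℝ} (hγ : 0 < γ) (hγe : γ ≤ Real.exp (-144)) (K : ℕ) :
    (γ * ((F.L : ℝ)⁻¹) ^ K)⁻¹ * Real.exp (-(B10.pFun 1 3 (Real.sqrt (γ * ((F.L : ℝ)⁻¹) ^ K)) ^ 2 / 24)) ≤ 1 := by
  have hγ1 : γ ≤ 1 := hγe.trans (Real.exp_le_one_iff.mpr (by norm_num))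
  obtain ⟨hxpos, hxle, hβ1⟩ := coupling_facts F hγ hγ1 K
  set x : ℝ := γ * ((F.L : ℝ)⁻¹) ^ K with hxdef
  set g : ℝ := Real.sqrt x with hgdef
  have hgpos : 0 < g := Real.sqrt_pos.mpr hxpos
  -- `log g⁻¹ = ½ log x⁻¹ ≥ 72`
  have hlogg : Real.log g⁻¹ = Real.log x⁻¹ / 2 := by
    rw [hgdef, Real.log_inv, Real.log_inv, Real.log_sqrt hxpos.le]; ring
  have hlogx : 144 ≤ Real.log x⁻¹ := by
    have h1 : x ≤ Real.exp (-144) := hxle.trans hγe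
    have h2 : Real.log x ≤ -144 := by rw [← Real.log_exp (-144)]; exact Real.log_le_log hxpos h1
    rw [Real.log_inv]; linarith
  have h72 : (8 * 0 + 72) / (1 : ℝ) ^ 2 ≤ Real.log g⁻¹ := by
    rw [hlogg, show (8 * 0 + 72) / (1 : ℝ) ^ 2 = 72 by norm_num]; linarith
  have hp := sq_pFun_ge (b₀ := 1) (p₀ := 3) (A := 0) one_pos (by norm_num) le_rfl h72
  -- `exp(−p²/24) ≤ exp(−log x⁻¹) = x`
  have hexp : Real.exp (-(B10.pFun 1 3 g ^ 2 / 24)) ≤ x := by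
    have hlog0 : 0 ≤ Real.log x⁻¹ := by linarith
    calc Real.exp (-(B10.pFun 1 3 g ^ 2 / 24)) ≤ Real.exp (-Real.log x⁻¹) := Real.exp_le_exp.mpr (by
            rw [hlogg] at hp; linarith)
      _ = x := by rw [Real.log_inv, neg_neg, Real.exp_log hxpos]
  calc x⁻¹ * Real.exp (-(B10.pFun 1 3 g ^ 2 / 24)) ≤ x⁻¹ * x := mul_le_mul_of_nonneg_left hexp (inv_nonneg.mpr hxpos.le)
    _ = 1 := inv_mul_cancel₀ hxpos.ne'

/-- **THE ENGINE OF §5** (one family, one coupling, one cut-off).  If a tilt bound `∫exp(c₀β_K·X) dGibbs_K ≤ exp(C₀·#Plaq_0)` holds for a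
bounded measurable `X ≥` the plaquette squares up to the edge indicators (`Σ_a|U(∂a) − 1|² ≤ X(U) + Σ_a 4·1[θ ≤ |U(∂a) − 1|]`), and each
single-plaquette edge event has `Gibbs_K{θ ≤ |U(∂a) − 1|} ≤ δ` with `β_K·δ ≤ 1`, then `β_K·∫Σ_a|U(∂a) − 1|² dGibbs_K ≤ (C₀/c₀ + 4)·#Plaq_0`
(Jensen: `c₀β_K∫X ≤ log∫exp(c₀β_KX) ≤ C₀#Plaq_0`). [folklore] -/
theorem mean_sqSum_le_of_tilt {γ c₀ C₀ B θ δ : ℝ} (hγ : 0 < γ) (hc₀ : 0 < c₀) (K : ℕ)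
    {X : GaugeField (F.P K) 0 (Matrix.specialUnitaryGroup (Fin 2) ℂ) → ℝ} (hXm : Measurable X) (hXb : ∀ U, |X U| ≤ B)
    (htilt : ∫ U, Real.exp (c₀ * (γ * ((F.L : ℝ)⁻¹) ^ K)⁻¹ * X U) ∂(gibbsK F ℰp γ K) ≤
      Real.exp (C₀ * (Fintype.card (Plaq (F.P K) 0) : ℝ)))
    (hdom : ∀ U : GaugeField (F.P K) 0 (Matrix.specialUnitaryGroup (Fin 2) ℂ),
      ∑ a : Plaq (F.P K) 0, dist1 (GaugeField.plaqHol U a) ^ 2 ≤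
        X U + ∑ a : Plaq (F.P K) 0, (if θ ≤ dist1 (GaugeField.plaqHol U a) then (4 : ℝ) else 0))
    (hP : ∀ a : Plaq (F.P K) 0, (gibbsK F ℰp γ K).real {U | θ ≤ dist1 (GaugeField.plaqHol U a)} ≤ δ)
    (hβδ : (γ * ((F.L : ℝ)⁻¹) ^ K)⁻¹ * δ ≤ 1) :
    (γ * ((F.L : ℝ)⁻¹) ^ K)⁻¹ * ∫ U, (∑ a : Plaq (F.P K) 0, dist1 (GaugeField.plaqHol U a) ^ 2) ∂(gibbsK F ℰp γ K) ≤
      (C₀ / c₀ + 4) * (Fintype.card (Plaq (F.P K) 0) : ℝ) := by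
  set β : ℝ := (γ * ((F.L : ℝ)⁻¹) ^ K)⁻¹ with hβdef
  set n : ℝ := (Fintype.card (Plaq (F.P K) 0) : ℝ) with hndef
  have hβ0 : 0 < β := CoarseStiffnessTailEdgeBulk.beta_pos F hγ K
  have hn : 0 ≤ n := Nat.cast_nonneg _
  haveI := isProbabilityMeasure_gibbsK F ℰp hγ.le K
  -- (i) Jensen: `β ∫X ≤ C₀ n / c₀`
  have hJ : β * ∫ U, X U ∂(gibbsK F ℰp γ K) ≤ C₀ / c₀ * n := by
    have h1 := integral_le_log_integral_exp (μ := gibbsK F ℰp γ K) (hXm.const_mul (c₀ * β)) (M := |c₀ * β| * B)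
      (fun U => by rw [abs_mul]; exact mul_le_mul_of_nonneg_left (hXb U) (abs_nonneg _))
    rw [integral_const_mul] at h1
    have hpos : 0 < ∫ U, Real.exp (c₀ * β * X U) ∂(gibbsK F ℰp γ K) := lt_of_lt_of_le (Real.exp_pos _)
      (exp_integral_le_integral_exp (μ := gibbsK F ℰp γ K) (hXm.const_mul (c₀ * β)) (M := |c₀ * β| * B)
        (fun U => by rw [abs_mul]; exact mul_le_mul_of_nonneg_left (hXb U) (abs_nonneg _)))
    have h2 : Real.log (∫ U, Real.exp (c₀ * β * X U) ∂(gibbsK F ℰp γ K)) ≤ C₀ * n := by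
      rw [← Real.log_exp (C₀ * n)]; exact Real.log_le_log hpos htilt
    have h3 : c₀ * (β * ∫ U, X U ∂(gibbsK F ℰp γ K)) ≤ c₀ * (C₀ / c₀ * n) := by
      rw [← mul_assoc, show c₀ * (C₀ / c₀ * n) = C₀ * n by field_simp]; linarith
    exact le_of_mul_le_mul_left h3 hc₀
  -- (ii) the edge indicators: `β ∫ Σ_a 4·1[θ ≤ d_a] ≤ 4 n`
  have hedge_int : ∀ a : Plaq (F.P K) 0, Integrable (fun U : GaugeField (F.P K) 0 (Matrix.specialUnitaryGroup (Fin 2) ℂ) =>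
      (if θ ≤ dist1 (GaugeField.plaqHol U a) then (4 : ℝ) else 0)) (gibbsK F ℰp γ K) := fun a =>
    integrable_of_bounded (Measurable.ite (measurableSet_le measurable_const (measurable_dist1_plaqHol F K a))
      measurable_const measurable_const) (M := 4) fun U => by split_ifs <;> norm_num
  have hE : β * ∫ U, (∑ a : Plaq (F.P K) 0, (if θ ≤ dist1 (GaugeField.plaqHol U a) then (4 : ℝ) else 0)) ∂(gibbsK F ℰp γ K) ≤
      4 * n := by
    rw [integral_finsetSum _ fun a _ => hedge_int a]
    calc β * ∑ a : Plaq (F.P K) 0, ∫ U, (if θ ≤ dist1 (GaugeField.plaqHol U a) then (4 : ℝ) else 0) ∂(gibbsK F ℰp γ K)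
        = ∑ a : Plaq (F.P K) 0, 4 * (β * (gibbsK F ℰp γ K).real {U | θ ≤ dist1 (GaugeField.plaqHol U a)}) := by
          rw [Finset.mul_sum]; refine Finset.sum_congr rfl fun a _ => ?_; rw [integral_edge_indicator F γ K θ a]; ring
      _ ≤ ∑ _a : Plaq (F.P K) 0, (4 : ℝ) := Finset.sum_le_sum fun a _ => by
          have := mul_le_mul_of_nonneg_left (hP a) hβ0.le
          linarith
      _ = 4 * n := by rw [Finset.sum_const, Finset.card_univ, nsmul_eq_mul, mul_comm]
  -- (iii) integrate the domination
  have hsq_int : Integrable (fun U : GaugeField (F.P K) 0 (Matrix.specialUnitaryGroup (Fin 2) ℂ) =>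
      ∑ a : Plaq (F.P K) 0, dist1 (GaugeField.plaqHol U a) ^ 2) (gibbsK F ℰp γ K) :=
    integrable_of_bounded (measurable_sqSum F K) (M := 4 * n) fun U => by
      obtain ⟨h0, h4⟩ := sqSum_mem F U; rw [abs_of_nonneg h0]; exact h4
  have hX_int : Integrable X (gibbsK F ℰp γ K) := integrable_of_bounded hXm hXb
  have hsum_int := integrable_finsetSum (Finset.univ) fun a _ => hedge_int a
  have hdom_int : ∫ U, (∑ a : Plaq (F.P K) 0, dist1 (GaugeField.plaqHol U a) ^ 2) ∂(gibbsK F ℰp γ K) ≤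
      ∫ U, X U ∂(gibbsK F ℰp γ K) +
        ∫ U, (∑ a : Plaq (F.P K) 0, (if θ ≤ dist1 (GaugeField.plaqHol U a) then (4 : ℝ) else 0)) ∂(gibbsK F ℰp γ K) := by
    rw [← integral_add hX_int hsum_int]
    exact integral_mono hsq_int (hX_int.add hsum_int) fun U => by simpa using hdom U
  calc β * ∫ U, (∑ a : Plaq (F.P K) 0, dist1 (GaugeField.plaqHol U a) ^ 2) ∂(gibbsK F ℰp γ K)
      ≤ β * ∫ U, X U ∂(gibbsK F ℰp γ K) +
          β * ∫ U, (∑ a : Plaq (F.P K) 0, (if θ ≤ dist1 (GaugeField.plaqHol U a) then (4 : ℝ) else 0)) ∂(gibbsK F ℰp γ K) := by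
        rw [← mul_add]; exact mul_le_mul_of_nonneg_left hdom_int hβ0.le
    _ ≤ C₀ / c₀ * n + 4 * n := add_le_add hJ hE
    _ = (C₀ / c₀ + 4) * n := by ring

end FacesToMean

section FacesToMean2

/-- The single-plaquette Peierls bound at the window edge, from the landed joint bound for families (`jointPeierls_bare`, `S = {a}`):
`Gibbs_K{θ(K) ≤ |U(∂a) − 1|} ≤ exp(−p(g_K)²/24)` for `γ ≤ γ₁(b₀)`. [cite: Balaban1985UV3, (71) p.273] -/
theorem singlePeierls_bare {b₀ p₀ : ℝ} (hb₀ : 0 < b₀) (hp₀ : 1 ≤ p₀) :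
    ∃ γ₁ : ℝ, 0 < γ₁ ∧ γ₁ ≤ 1 ∧ ∀ (F : T3Family) (γ : ℝ), 0 < γ → γ ≤ γ₁ → ∀ (K : ℕ) (a : Plaq (F.P K) 0),
      (gibbsK F ℰp γ K).real {U | θBal F.L γ b₀ p₀ K ≤ dist1 (GaugeField.plaqHol U a)} ≤
        Real.exp (-(B10.pFun b₀ p₀ (Real.sqrt (γ * ((F.L : ℝ)⁻¹) ^ K)) ^ 2 / 24)) := by
  obtain ⟨γ₁, hγ₁, hγ₁1, hP⟩ := jointPeierls_bare hb₀ hp₀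
  refine ⟨γ₁, hγ₁, hγ₁1, fun F γ hγ hγ1 K a => ?_⟩
  have h := hP F γ hγ hγ1 K {a}
  have hset : {U : GaugeField (F.P K) 0 (Matrix.specialUnitaryGroup (Fin 2) ℂ) |
      ∀ q ∈ ({a} : Finset (Plaq (F.P K) 0)), θBal F.L γ b₀ p₀ K ≤ dist1 (GaugeField.plaqHol U q)} =
      {U | θBal F.L γ b₀ p₀ K ≤ dist1 (GaugeField.plaqHol U a)} := by
    ext U; simp
  rw [hset, Finset.card_singleton, Nat.cast_one, mul_one] at h
  exact h

/-- **THE `j = 0` FACE OF THE CRUX ⇒ UNIFORM MEAN ACTION.**  If the bare capped stiffness has free energy `O(1)` per plaquette for every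
profile (constants before `(F, γ, K)`), then `β_K·∫Σ_a|U(∂a) − 1|² dGibbs_K ≤ C·#Plaq_0` uniformly: at the profile `(1, 3)`, Jensen gives the
capped mean, and ABOVE the window edge the landed joint Peierls bound (`jointPeierls_bare`, rate `p(g_K)²/24 ≥ (3/2)log β_K` once
`γ ≤ e^{−144}`) pays the one power of `β_K` (§5 engine with `X` = the capped sum, `δ = e^{−p²/24}`). [cite: Balaban1985UV3, (7) p.257 and (71) p.273] -/
theorem uma_of_crux0
    (h : ∀ (L : ℕ) (b₀ p₀ : ℝ), 0 < b₀ → 2 < p₀ → ∃ (c₀ C₀ γ₁ : ℝ), 0 < c₀ ∧ 0 < γ₁ ∧ γ₁ ≤ 1 ∧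
      ∀ (F : T3Family) (γ : ℝ), F.L = L → 0 < γ → γ ≤ γ₁ → ∀ (K : ℕ),
        ∫ U, Real.exp (c₀ * (γ * ((F.L : ℝ)⁻¹) ^ K)⁻¹ *
            ∑ a : Plaq (F.P K) 0, min (dist1 (GaugeField.plaqHol U a) ^ 2) (θBal F.L γ b₀ p₀ K ^ 2)) ∂(gibbsK F ℰp γ K) ≤
          Real.exp (C₀ * (Fintype.card (Plaq (F.P K) 0) : ℝ))) :
    ∀ (L : ℕ), ∃ (C γ₁ : ℝ), 0 < γ₁ ∧ γ₁ ≤ 1 ∧ ∀ (F : T3Family) (γ : ℝ), F.L = L → 0 < γ → γ ≤ γ₁ → ∀ (K : ℕ),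
      (γ * ((F.L : ℝ)⁻¹) ^ K)⁻¹ * ∫ U, (∑ a : Plaq (F.P K) 0, dist1 (GaugeField.plaqHol U a) ^ 2) ∂(gibbsK F ℰp γ K) ≤
        C * (Fintype.card (Plaq (F.P K) 0) : ℝ) := by
  intro L
  obtain ⟨c₀, C₀, γ₁, hc₀, hγ₁, hγ₁1, hX⟩ := h L 1 3 one_pos (by norm_num)
  obtain ⟨γ₂, hγ₂, hγ₂1, hP⟩ := singlePeierls_bare (b₀ := 1) (p₀ := 3) one_pos (by norm_num)
  refine ⟨C₀ / c₀ + 4, min γ₁ (min γ₂ (Real.exp (-144))), lt_min hγ₁ (lt_min hγ₂ (Real.exp_pos _)),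
    (min_le_left _ _).trans hγ₁1, fun F γ hL hγ hγle K => ?_⟩
  have hγ1 : γ ≤ γ₁ := hγle.trans (min_le_left _ _)
  have hγ2 : γ ≤ γ₂ := hγle.trans ((min_le_right _ _).trans (min_le_left _ _))
  have hγe : γ ≤ Real.exp (-144) := hγle.trans ((min_le_right _ _).trans (min_le_right _ _))
  set θ : ℝ := θBal F.L γ 1 3 K with hθdef
  refine mean_sqSum_le_of_tilt F hγ hc₀ K (θ := θ) (B := (Fintype.card (Plaq (F.P K) 0) : ℝ) * θ ^ 2)
    (X := fun U => ∑ a : Plaq (F.P K) 0, min (dist1 (GaugeField.plaqHol U a) ^ 2) (θ ^ 2))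
    (Finset.measurable_sum _ fun a _ => ((measurable_dist1_plaqHol F K a).pow_const 2).min measurable_const)
    (fun U => ?_) (hX F γ hL hγ hγ1 K) (fun U => ?_) (fun a => hP F γ hγ hγ2 K a) (beta_mul_exp_neg_profile_le_one F hγ hγe K)
  · -- `0 ≤ X ≤ n θ²`
    have h0 : 0 ≤ ∑ a : Plaq (F.P K) 0, min (dist1 (GaugeField.plaqHol U a) ^ 2) (θ ^ 2) :=
      Finset.sum_nonneg fun a _ => le_min (sq_nonneg _) (sq_nonneg _)
    rw [abs_of_nonneg h0]
    calc ∑ a : Plaq (F.P K) 0, min (dist1 (GaugeField.plaqHol U a) ^ 2) (θ ^ 2) ≤ ∑ _a : Plaq (F.P K) 0, θ ^ 2 :=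
          Finset.sum_le_sum fun a _ => min_le_right _ _
      _ = (Fintype.card (Plaq (F.P K) 0) : ℝ) * θ ^ 2 := by rw [Finset.sum_const, Finset.card_univ, nsmul_eq_mul]
  · -- domination
    rw [← Finset.sum_add_distrib]
    exact Finset.sum_le_sum fun a _ => sq_le_capped_add_edge (GaugeField.plaqHol U a) θ

/-- **THE `j = 0` FACE OF THE BULK STUB ⇒ UNIFORM MEAN ACTION** (same road with `X` = the sub-threshold sum). [cite: Balaban1985UV3, (7) p.257 and (71) p.273] -/
theorem uma_of_bulk0
    (h : ∀ (L : ℕ) (b₀ p₀ : ℝ), 0 < b₀ → 2 < p₀ → ∃ (c₀ C₀ γ₁ : ℝ), 0 < c₀ ∧ 0 < γ₁ ∧ γ₁ ≤ 1 ∧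
      ∀ (F : T3Family) (γ : ℝ), F.L = L → 0 < γ → γ ≤ γ₁ → ∀ (K : ℕ),
        ∫ U, Real.exp (c₀ * (γ * ((F.L : ℝ)⁻¹) ^ K)⁻¹ *
            ∑ a : Plaq (F.P K) 0, (if dist1 (GaugeField.plaqHol U a) < θBal F.L γ b₀ p₀ K then
              dist1 (GaugeField.plaqHol U a) ^ 2 else 0)) ∂(gibbsK F ℰp γ K) ≤
          Real.exp (C₀ * (Fintype.card (Plaq (F.P K) 0) : ℝ))) :
    ∀ (L : ℕ), ∃ (C γ₁ : ℝ), 0 < γ₁ ∧ γ₁ ≤ 1 ∧ ∀ (F : T3Family) (γ : ℝ), F.L = L → 0 < γ → γ ≤ γ₁ → ∀ (K : ℕ),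
      (γ * ((F.L : ℝ)⁻¹) ^ K)⁻¹ * ∫ U, (∑ a : Plaq (F.P K) 0, dist1 (GaugeField.plaqHol U a) ^ 2) ∂(gibbsK F ℰp γ K) ≤
        C * (Fintype.card (Plaq (F.P K) 0) : ℝ) := by
  intro L
  obtain ⟨c₀, C₀, γ₁, hc₀, hγ₁, hγ₁1, hX⟩ := h L 1 3 one_pos (by norm_num)
  obtain ⟨γ₂, hγ₂, hγ₂1, hP⟩ := singlePeierls_bare (b₀ := 1) (p₀ := 3) one_pos (by norm_num)
  refine ⟨C₀ / c₀ + 4, min γ₁ (min γ₂ (Real.exp (-144))), lt_min hγ₁ (lt_min hγ₂ (Real.exp_pos _)),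
    (min_le_left _ _).trans hγ₁1, fun F γ hL hγ hγle K => ?_⟩
  have hγ1 : γ ≤ γ₁ := hγle.trans (min_le_left _ _)
  have hγ2 : γ ≤ γ₂ := hγle.trans ((min_le_right _ _).trans (min_le_left _ _))
  have hγe : γ ≤ Real.exp (-144) := hγle.trans ((min_le_right _ _).trans (min_le_right _ _))
  set θ : ℝ := θBal F.L γ 1 3 K with hθdef
  refine mean_sqSum_le_of_tilt F hγ hc₀ K (θ := θ) (B := (Fintype.card (Plaq (F.P K) 0) : ℝ) * θ ^ 2)
    (X := fun U => ∑ a : Plaq (F.P K) 0, (if dist1 (GaugeField.plaqHol U a) < θ then dist1 (GaugeField.plaqHol U a) ^ 2 else 0))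
    (Finset.measurable_sum _ fun a _ => Measurable.ite (measurableSet_lt (measurable_dist1_plaqHol F K a) measurable_const)
      ((measurable_dist1_plaqHol F K a).pow_const 2) measurable_const)
    (fun U => ?_) (hX F γ hL hγ hγ1 K) (fun U => ?_) (fun a => hP F γ hγ hγ2 K a) (beta_mul_exp_neg_profile_le_one F hγ hγe K)
  · -- `0 ≤ X ≤ n θ²`
    have hterm : ∀ a : Plaq (F.P K) 0,
        0 ≤ (if dist1 (GaugeField.plaqHol U a) < θ then dist1 (GaugeField.plaqHol U a) ^ 2 else 0) ∧
          (if dist1 (GaugeField.plaqHol U a) < θ then dist1 (GaugeField.plaqHol U a) ^ 2 else 0) ≤ θ ^ 2 := fun a => by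
      have hd := GaugeGroup.dist1_nonneg (GaugeField.plaqHol U a)
      split_ifs with hlt
      · exact ⟨sq_nonneg _, pow_le_pow_left₀ hd hlt.le 2⟩
      · exact ⟨le_rfl, sq_nonneg _⟩
    rw [abs_of_nonneg (Finset.sum_nonneg fun a _ => (hterm a).1)]
    calc ∑ a : Plaq (F.P K) 0, (if dist1 (GaugeField.plaqHol U a) < θ then dist1 (GaugeField.plaqHol U a) ^ 2 else 0)
        ≤ ∑ _a : Plaq (F.P K) 0, θ ^ 2 := Finset.sum_le_sum fun a _ => (hterm a).2
      _ = (Fintype.card (Plaq (F.P K) 0) : ℝ) * θ ^ 2 := by rw [Finset.sum_const, Finset.card_univ, nsmul_eq_mul]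
  · -- domination
    rw [← Finset.sum_add_distrib]
    exact Finset.sum_le_sum fun a _ => sq_le_bulk_add_edge (GaugeField.plaqHol U a) θ

end FacesToMean2

end Summit.QuantumFields.YangMills.Theorems.CoarseStiffnessTailBareStiffnessOfMeanAction

end
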